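import Summits.QuantumFields.YangMills.Theorems.AllWindowsColdBoxBoxHighLineActionSandwich

/-!
# U5-L5 (i) = T-S5.6a′ «sharp action sandwich»: `|S(U(a)) + Φ(U(a)) − boxQuadForm H a| ≤ C·t·(boxQuadForm H a + Σ_e ‖a_e‖²)` — NO factor `H`

Width seat `ym-line-sfw-p2-w2` (prover-ym-line-sfw-p2-w2-g32-0), the 6a lineage (✓`actionSandwich`, w2 g30/g31), on planner ym-idea-2 g18's typed task
`Cruxes/BoxWindowHighSU2213/TaskU5L5.lean` (2026-08-29T22:08Z; bus 22:06:13Z «L5 (i) → w2»), lift **L5** of `U5-BLOCKERS.md` B5 for the next rung U5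
(LINE-20 ⟨stmt-QuantumFields-24336⟩, `stub_landauThirdOrder`; U5 prep, helper — U5 is UNSTAFFED, I23 open).

✓6a `actionSandwich` bounds the sandwich error by `C·t·H·boxQuadForm` (hypothesis `t·H ≤ c₀`): the `H` is the price of converting the edge mass
`N(a) = Σ_e ‖a_e‖²` into the Hodge form by the Poincaré floor ✓`BoxQuadForm.sum_norm_sq_le_boxQuadForm` (`N ≤ 344·H²·Q`) inside a global
Cauchy–Schwarz, and it is SHARP pointwise (the cubic Yang–Mills vertex on smooth low modes, w2 g31 2026-08-29T21:25Z).  The planner's repaired 6a′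
keeps `N` separate: **`|S + Φ − Q| ≤ C·t·(Q + N)` for `‖a_e‖ ≤ t ≤ c₀`, with NO factor `H`** — the input of T-S5.6′ `SmallFieldInsideFPSharp`
(two-form Gaussian domination `Q_∓ = (1 ∓ Cr)Q ∓ Cr·N`, exponent `C·r·H⁴(1 + log H)` instead of `C·r·H⁵`).

Proof = the 6a proof with ONE AM–GM changed: per plaquette ✓brick 3 `WilsonSandwich.abs_chartPlaqCost_sub_norm_sq_le`
`|c_p − ‖b_p‖²| ≤ 3t‖b_p‖·Σ_i‖v_i‖ + 13t²Σ_i‖v_i‖²`, and `3t‖b_p‖Σ‖v_i‖ ≤ (3t/2)(‖b_p‖² + (Σ‖v_i‖)²) ≤ (3t/2)‖b_p‖² + 6t·Σ‖v_i‖²`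
(✓`sq_sum_norm_le_four_mul`); summing with ✓`sum_norm_plaqLin_sq_le` (`Σ_p‖b_p‖² ≤ Q`) and ✓`sum_plaqVar_norm_sq_le` (`Σ_pΣ_i‖v_i‖² ≤ 24N`):
WILSON half `≤ (3/2)t·Q + 456t·N`; GAUGE-FIXING half ✓`phiTaylor` clause 2 + ✓`ActionSandwichProof.sum_sq_sum_abs_gradVec_le`:
`|Φ − Σ|d*a|²| ≤ 16·C_Φ·t²·N ≤ 16·C_Φ·t·N` (`t ≤ 1`).

* `ActionSandwichSharpProof.abs_boxWilson_sub_sum_linCurvSq_le_sharp` — the Wilson half, `(3/2)t·Q + 456t·N`;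
* ★★ **`abs_action_sub_boxQuadForm_le_sharp`** — `∃ C > 0, ∀ H ≥ 1, ∀ t ∈ [0,1], ∀ a (‖a_e‖ ≤ t), |S + Φ − Q| ≤ C·t·(Q + Σ_e‖a_e‖²)`
  (`C = 458 + 16·max C_Φ 0`; def-free form; the by-name `actionSandwichSharp : ActionSandwichSharp` with the task's `edgeMass` letter is the
  companion file `…ActionSandwichSharpByName`).

Everything proved; no definitions; Mathlib + tree only; standard axioms.  HONEST LABEL: an S/M support brick (U5 prep, helper) for lift L5 of the NEXT
rung U5 of a critic-PASSed DRAFT line; T-S5.6′, U5, ⟨24336⟩, ⟨24004⟩ remain OPEN; no stub is closed by name; no crux, rung or summit is proved;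
**the Yang–Mills mass gap is NOT proved by this file; no summit is proved by a line.**
-/

set_option autoImplicit false

noncomputable section

open Matrix Finset
open Literature.Probability.LatticeModels (Site)
open Literature.MathematicalPhysics.QuantumFieldTheory.AxialGauge (boxEdges)
open Literature.MathematicalPhysics.QuantumLattice (ZdPlaquette plaquettesTouching)

namespace Summit.QuantumFields.YangMills.Theorems.AllWindowsColdBoxBoxHighLine

namespace ActionSandwichSharpProof

variable {H : ℕ}

open WilsonSandwich in
/-- **The Wilson half, sharp form.**  For `H ≥ 1`, `‖a_e‖ ≤ t ≤ 1`:
`|S(U(a)) − Σ_{p touching} |ℓ_p(a)|²| ≤ (3/2)·t·boxQuadForm H a + 456·t·Σ_e ‖a_e‖²` (AM–GM per plaquette instead of the global Cauchy–Schwarz +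
Poincaré of ✓brick 5). -/
theorem abs_boxWilson_sub_sum_linCurvSq_le_sharp (hH : 1 ≤ H) {t : ℝ} (ht0 : 0 ≤ t) (ht : t ≤ 1)
    (a : LandauFree H → E3) (ha : ∀ e, ‖a e‖ ≤ t) :
    |boxWilson H (edgeChart H a) - ∑ p ∈ plaquettesTouching (boxEdges 4 (2 * H + 1)), linCurvSq H (p.1, p.2.1.1, p.2.1.2) a| ≤
      3 / 2 * t * boxQuadForm H a + 456 * t * ∑ e : LandauFree H, ‖a e‖ ^ 2 := by
  classical
  set P := plaquettesTouching (boxEdges 4 (2 * H + 1)) with hP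
  set Q := boxQuadForm H a with hQ
  set N := ∑ e : LandauFree H, ‖a e‖ ^ 2 with hN
  set nb : ZdPlaquette 4 → ℝ := fun p => ‖plaqLin (plaqVar H p.1 p.2.1.1 p.2.1.2 a)‖ with hnb
  set A : ZdPlaquette 4 → ℝ := fun p => ∑ i : Fin 4, ‖plaqVar H p.1 p.2.1.1 p.2.1.2 a i‖ with hA
  set B : ZdPlaquette 4 → ℝ := fun p => ∑ i : Fin 4, ‖plaqVar H p.1 p.2.1.1 p.2.1.2 a i‖ ^ 2 with hB
  have hN0 : 0 ≤ N := Finset.sum_nonneg fun _ _ => sq_nonneg _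
  -- Σ B ≤ 24 N, Σ nb² ≤ Q
  have hBsum : ∑ p ∈ P, B p ≤ 24 * N := sum_plaqVar_norm_sq_le H a
  have hnb2 : ∑ p ∈ P, nb p ^ 2 ≤ Q := sum_norm_plaqLin_sq_le hH a
  -- Σ A² ≤ 4 Σ B
  have hA2 : ∑ p ∈ P, A p ^ 2 ≤ 4 * ∑ p ∈ P, B p := by
    rw [Finset.mul_sum]
    refine Finset.sum_le_sum fun p _ => ?_
    exact sq_sum_norm_le_four_mul _
  -- AM–GM at the level of the plaquette sums: `Σ nb·A ≤ (Σ nb² + Σ A²)/2 ≤ (Q + 4ΣB)/2`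
  have hnbA : ∑ p ∈ P, nb p * A p ≤ (Q + 4 * ∑ p ∈ P, B p) / 2 := by
    have h1 : ∑ p ∈ P, nb p * A p ≤ ∑ p ∈ P, (nb p ^ 2 + A p ^ 2) / 2 :=
      Finset.sum_le_sum fun p _ => by linarith [two_mul_le_add_sq (nb p) (A p)]
    have h2 : ∑ p ∈ P, (nb p ^ 2 + A p ^ 2) / 2 = (∑ p ∈ P, nb p ^ 2 + ∑ p ∈ P, A p ^ 2) / 2 := by
      rw [← Finset.sum_div, Finset.sum_add_distrib]
    rw [h2] at h1
    have h3 : (∑ p ∈ P, nb p ^ 2 + ∑ p ∈ P, A p ^ 2) / 2 ≤ (Q + 4 * ∑ p ∈ P, B p) / 2 := by linarith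
    exact h1.trans h3
  -- per plaquette (✓brick 3, folded exactly as in ✓brick 5)
  have hper : ∀ p ∈ P, |chartPlaqCost H p.1 p.2.1.1 p.2.1.2 a - linCurvSq H (p.1, p.2.1.1, p.2.1.2) a| ≤
      3 * t * (nb p * A p) + 13 * t ^ 2 * B p := by
    intro p _
    rw [linCurvSq_eq_norm_sq]
    have h := abs_chartPlaqCost_sub_norm_sq_le H p.1 p.2.1.1 p.2.1.2 a ht0 ht
      (fun i => SmallFieldPlaq.norm_freeVec_le (show a ∈ smallField H t from ha) ht0 _)
    simpa only [hnb, hA, hB, mul_assoc] using h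
  rw [boxWilson_edgeChart_eq_sum, ← Finset.sum_sub_distrib]
  have hB0 : 0 ≤ ∑ p ∈ P, B p := Finset.sum_nonneg fun p _ => Finset.sum_nonneg fun _ _ => sq_nonneg _
  have ht2 : t ^ 2 ≤ t := by nlinarith
  calc |∑ p ∈ P, (chartPlaqCost H p.1 p.2.1.1 p.2.1.2 a - linCurvSq H (p.1, p.2.1.1, p.2.1.2) a)|
      ≤ ∑ p ∈ P, |chartPlaqCost H p.1 p.2.1.1 p.2.1.2 a - linCurvSq H (p.1, p.2.1.1, p.2.1.2) a| := Finset.abs_sum_le_sum_abs _ _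
    _ ≤ ∑ p ∈ P, (3 * t * (nb p * A p) + 13 * t ^ 2 * B p) := Finset.sum_le_sum hper
    _ = 3 * t * ∑ p ∈ P, nb p * A p + 13 * t ^ 2 * ∑ p ∈ P, B p := by
        rw [Finset.sum_add_distrib, Finset.mul_sum, Finset.mul_sum]
    _ ≤ 3 * t * ((Q + 4 * ∑ p ∈ P, B p) / 2) + 13 * t ^ 2 * ∑ p ∈ P, B p :=
        add_le_add (mul_le_mul_of_nonneg_left hnbA (by linarith)) le_rfl
    _ = 3 / 2 * t * Q + (6 * t + 13 * t ^ 2) * ∑ p ∈ P, B p := by ring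
    _ ≤ 3 / 2 * t * Q + (6 * t + 13 * t ^ 2) * (24 * N) :=
        add_le_add le_rfl (mul_le_mul_of_nonneg_left hBsum (by nlinarith))
    _ ≤ 3 / 2 * t * Q + 19 * t * (24 * N) := by
        have h24 : 0 ≤ 24 * N := by linarith
        have h19 : (6 * t + 13 * t ^ 2) * (24 * N) ≤ 19 * t * (24 * N) := mul_le_mul_of_nonneg_right (by linarith) h24
        linarith
    _ = 3 / 2 * t * Q + 456 * t * N := by ring

end ActionSandwichSharpProof

open ActionSandwichSharpProof ActionSandwichProof in
/-- ★★ **T-S5.6a′, sharp action sandwich (def-free form).**  There is `C > 0` such that for `H ≥ 1`, `0 ≤ t ≤ 1` and every edge field with all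
`‖a_e‖ ≤ t`:  `|S(U(a)) + Φ(U(a)) − boxQuadForm H a| ≤ C·t·(boxQuadForm H a + Σ_e ‖a_e‖²)` (`C = 458 + 16·max C_Φ 0`). -/
theorem abs_action_sub_boxQuadForm_le_sharp : ∃ C : ℝ, 0 < C ∧ ∀ H : ℕ, 1 ≤ H → ∀ t : ℝ, 0 ≤ t → t ≤ 1 →
    ∀ a : LandauFree H → E3, (∀ e, ‖a e‖ ≤ t) →
      |boxWilson H (edgeChart H a) + landauPhi H (edgeChart H a) - boxQuadForm H a| ≤
        C * t * (boxQuadForm H a + ∑ e : LandauFree H, ‖a e‖ ^ 2) := by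
  obtain ⟨C, hC⟩ := phiTaylor
  refine ⟨458 + 16 * max C 0, by positivity, fun H hH t ht0 ht1 a ha => ?_⟩
  have hQ0 : 0 ≤ boxQuadForm H a := BoxQuadForm.boxQuadForm_nonneg hH a
  have hN0 : 0 ≤ ∑ e : LandauFree H, ‖a e‖ ^ 2 := Finset.sum_nonneg fun _ _ => sq_nonneg _
  have hW := abs_boxWilson_sub_sum_linCurvSq_le_sharp hH ht0 ht1 a ha
  -- the gauge-fixing half: `|Φ − Σ|d*a|²| ≤ max C 0 · 16 t² N`
  have hΦ : |landauPhi H (edgeChart H a) - divLinSq H a| ≤ max C 0 * (16 * t ^ 2 * ∑ e : LandauFree H, ‖a e‖ ^ 2) := by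
    have hX0 : 0 ≤ ∑ x ∈ interiorSites H, (∑ e : LandauFree H, |gradVec H x e| * ‖a e‖ ^ 2) ^ 2 :=
      Finset.sum_nonneg fun _ _ => sq_nonneg _
    calc |landauPhi H (edgeChart H a) - divLinSq H a|
        ≤ C * ∑ x ∈ interiorSites H, (∑ e : LandauFree H, |gradVec H x e| * ‖a e‖ ^ 2) ^ 2 := (hC H hH a).2.1
      _ ≤ max C 0 * ∑ x ∈ interiorSites H, (∑ e : LandauFree H, |gradVec H x e| * ‖a e‖ ^ 2) ^ 2 :=
          mul_le_mul_of_nonneg_right (le_max_left C 0) hX0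
      _ ≤ max C 0 * (16 * t ^ 2 * ∑ e : LandauFree H, ‖a e‖ ^ 2) :=
          mul_le_mul_of_nonneg_left (sum_sq_sum_abs_gradVec_le H a ha) (le_max_right C 0)
  have hsplit := (quadFormSplit H hH a).1
  have hkey : boxWilson H (edgeChart H a) + landauPhi H (edgeChart H a) - boxQuadForm H a =
      (boxWilson H (edgeChart H a) -
          ∑ p ∈ plaquettesTouching (boxEdges 4 (2 * H + 1)), linCurvSq H (p.1, p.2.1.1, p.2.1.2) a) +
        (landauPhi H (edgeChart H a) - divLinSq H a) := by
    linarith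
  rw [hkey]
  have hmC : 0 ≤ max C 0 := le_max_right C 0
  have ht2 : t ^ 2 ≤ t := by nlinarith
  have e1 : max C 0 * (16 * t ^ 2 * ∑ e : LandauFree H, ‖a e‖ ^ 2) ≤ max C 0 * (16 * t * ∑ e : LandauFree H, ‖a e‖ ^ 2) :=
    mul_le_mul_of_nonneg_left (mul_le_mul_of_nonneg_right (by linarith) hN0) hmC
  calc |boxWilson H (edgeChart H a) -
            ∑ p ∈ plaquettesTouching (boxEdges 4 (2 * H + 1)), linCurvSq H (p.1, p.2.1.1, p.2.1.2) a +
          (landauPhi H (edgeChart H a) - divLinSq H a)|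
      ≤ |boxWilson H (edgeChart H a) -
            ∑ p ∈ plaquettesTouching (boxEdges 4 (2 * H + 1)), linCurvSq H (p.1, p.2.1.1, p.2.1.2) a| +
          |landauPhi H (edgeChart H a) - divLinSq H a| := abs_add_le _ _
    _ ≤ (3 / 2 * t * boxQuadForm H a + 456 * t * ∑ e : LandauFree H, ‖a e‖ ^ 2) +
          max C 0 * (16 * t * ∑ e : LandauFree H, ‖a e‖ ^ 2) := add_le_add hW (hΦ.trans e1)
    _ ≤ (458 + 16 * max C 0) * t * (boxQuadForm H a + ∑ e : LandauFree H, ‖a e‖ ^ 2) := by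
        set Q := boxQuadForm H a
        set N := ∑ e : LandauFree H, ‖a e‖ ^ 2
        have h1 : 0 ≤ t * Q := mul_nonneg ht0 hQ0
        have h2 : 0 ≤ t * N := mul_nonneg ht0 hN0
        have h3 : 0 ≤ max C 0 * (t * Q) := mul_nonneg hmC h1
        have hid : (458 + 16 * max C 0) * t * (Q + N) =
            (3 / 2 * t * Q + 456 * t * N + max C 0 * (16 * t * N)) + ((456 + 1 / 2) * (t * Q) + 2 * (t * N) + 16 * (max C 0 * (t * Q))) := by
          ring
        rw [hid]
        have h4 : 0 ≤ (456 + 1 / 2) * (t * Q) + 2 * (t * N) + 16 * (max C 0 * (t * Q)) := by linarith [h1, h2, h3]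
        linarith

end Summit.QuantumFields.YangMills.Theorems.AllWindowsColdBoxBoxHighLine

end
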